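import Literature.Analysis.FluidPDE.LerayHopfH1Test
import Literature.Analysis.FluidPDE.LerayHopfTimeSliceForced
import HarnessLib

/-!
# Leray–Hopf solutions of the FORCED system tested with `H¹_σ` fields (time-sliced form)

Analysis/FluidPDE support file: the **forced twin** of the main result of
`Literature/Analysis/FluidPDE/LerayHopfH1Test.lean` (`IsLerayHopfOn.inner_weakGrad_test_eq`, which
hard-codes `f = 0`). It serves the discharge of the forced Serrin–Masuda weak–strong uniqueness
theorem (Sohr 2001, Thm. V.1.5.1): Serrin's argument tests the weak formulation of one Leray–Hopf
solution with the other, i.e. with a field that is only in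
`H¹_σ = {Ψ ∈ L², div Ψ = 0 weakly, ∇Ψ ∈ L²}` (Serrin 1963, §4; Galdi 2000, Lemma 2.1 / (4.3);
Sohr 2001, proof of Thm. V.1.4.1).

**Main result** (`IsLerayHopfOn.inner_weakGrad_test_eq_forced`). Let `dim E = 3`, `u` a
Leray–Hopf weak solution of the FORCED Navier–Stokes system on `E × [0,T)` with datum `u₀ ∈ L²`
and force `f ∈ L²((0,T) × E)` (jointly a.e.-strongly measurable), `Gu` a jointly measurable
weak-gradient witness of `u` (a.e. in time) with `∫₀ᵀ∫ |Gu|² < ∞`, and `Ψ ∈ L²(E;E)` weakly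
divergence free with weak gradient `GΨ`, `∫ |GΨ|² < ∞`. Then for **every** `t ∈ (0, T]`

  `⟨u(t), Ψ⟩ = ⟨u₀, Ψ⟩ + ∫_{(0,t]} ( ∫ ⟪GΨ·u, u⟫ - ν Σᵢ ∫ ⟪Gu eᵢ, GΨ eᵢ⟫ + ∫ ⟪f, Ψ⟫ ) ds`

(Galdi 2000, Lemma 2.1 with (2.8) and the force; Serrin 1963, (6); Sohr 2001, Ch. V (1.4.4)): the
smooth-test version `IsLerayHopfOn.inner_test_eq_forced` (`LerayHopfTimeSliceForced`) extended by the
density of `C_{c,σ}^∞` in `H¹_σ` (`exists_isDivFree_test_approx`), exactly as in the unforced file —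
`⟨u, ΔΦ⟩ = -⟨∇u, ∇Φ⟩` (`HasWeakGradient.integral_inner_laplacian_test`), the flux error bound
`enorm_weakFlux_sub_le` with the integrable weight `‖u‖₄² + |ν| Σ‖Gu eᵢ‖₂`
(`IsLerayHopfOn.lintegral_weight_lt_top`) — plus ONE new limit, the force pairings:
`|∫₀ᵗ ⟨f(s), Φₙ - Ψ⟩ ds| ≤ ‖Φₙ - Ψ‖₂ ∫₀ᵀ ‖f(s)‖₂ ds → 0`
(`lintegral_eLpNorm_two_slice_lt_top_of_eLpNorm_prod`).

## Mathlib / tree search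

All fluid-specific inputs are the accepted force-generic lemmas of `LerayHopfH1Test`
(`lintegral_weight_lt_top`, `integrableOn_weakFlux`, `enorm_weakFlux_sub_le`,
`lintegral_eLpNorm_four_sq_lt_top`), `SolenoidalTruncation` (`exists_isDivFree_test_approx`) and
`LerayHopfTimeSliceForced`; `lean search 'inner_weakGrad_test_eq'` finds only the `f = 0` versions
(`LerayHopfH1Test`, `NSWeakStrongUniquenessHolds.inner_weakGrad_test_eq'`).

## References

* G. P. Galdi, *An introduction to the Navier–Stokes initial–boundary value problem*, in:
  Fundamental Directions in Mathematical Fluid Mechanics, Birkhäuser 2000, Lemma 2.1, Def. 2.1,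
  Thm. 4.2 (`Galdi2000`).
* J. Serrin, *The initial value problem for the Navier–Stokes equations*, in: Nonlinear Problems
  (Madison 1962), Univ. Wisconsin Press 1963, §§3–4 (`Serrin1963`).
* H. Sohr, *The Navier–Stokes Equations. An Elementary Functional Analytic Approach*,
  Birkhäuser 2001, Ch. V, Thm. 1.4.1 and its proof, Thm. 1.5.1 (`Sohr2001`).
-/

noncomputable section

open MeasureTheory TopologicalSpace Set Function Filter Topology ContinuousLinearMap Module
open scoped ENNReal NNReal Convolution InnerProductSpace RealInnerProductSpace Laplacian

namespace Literature.Analysis.FluidPDE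

variable {E : Type*} [NormedAddCommGroup E] [InnerProductSpace ℝ E] [FiniteDimensional ℝ E]
  [MeasurableSpace E] [BorelSpace E]

section H1TestForced

variable {T ν : ℝ} {f : ℝ → E → E} {u₀ : E → E} {u : ℝ → E → E}

/-- **The `H¹_σ` time-slice identity for Leray–Hopf solutions of the FORCED system** (Galdi 2000,
Lemma 2.1 with (2.8)/(4.3) and the force; Serrin 1963, (6); Sohr 2001, Ch. V (1.4.4); Robinson–
Rodrigo–Sadowski 2016, Lemma 8.18, density step). Let `dim E = 3`, `u` a Leray–Hopf weak solution
of the forced Navier–Stokes system on `E × [0,T)` with datum `u₀ ∈ L²` and force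
`f ∈ L²((0,T) × E)` (jointly a.e.-strongly measurable), `Gu` a jointly measurable weak-gradient
witness of `u` (a.e. in time) with `∫₀ᵀ ∫|Gu|² < ∞`, and `Ψ ∈ L²` weakly divergence free with weak
gradient `GΨ`, `∫|GΨ|² < ∞`. Then for every `t ∈ (0, T]`
`⟨u(t), Ψ⟩ = ⟨u₀, Ψ⟩ + ∫_{(0,t]} ( ∫ ⟪GΨ u, u⟫ - ν Σᵢ ∫ ⟪Gu eᵢ, GΨ eᵢ⟫ + ∫ ⟪f, Ψ⟫ ) ds`.
Proof: approximate `Ψ` in `H¹` by divergence-free test fields `Φₙ`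
(`exists_isDivFree_test_approx`), apply `IsLerayHopfOn.inner_test_eq_forced` to `Φₙ`, rewrite
`ν⟨u, ΔΦₙ⟩ = -ν Σᵢ ⟨Gu eᵢ, ∂ᵢΦₙ⟩` for a.e. `s`, and pass to the limit using `enorm_weakFlux_sub_le`,
`∫₀ᵀ(‖u‖₄² + |ν|Σ‖Gu eᵢ‖₂) < ∞` and, for the force pairings, `|∫⟪f(s), Φₙ - Ψ⟫| ≤ ‖f(s)‖₂ ‖Φₙ - Ψ‖₂`
with `∫₀ᵀ ‖f(s)‖₂ < ∞`. [cite: Galdi2000, Lemma 2.1 (with force); Sohr2001, Ch. V, proof of Thm. 1.4.1] -/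
theorem IsLerayHopfOn.inner_weakGrad_test_eq_forced (hE3 : finrank ℝ E = 3)
    (hu : IsLerayHopfOn T ν f u₀ u) (hu₀ : MemLp u₀ 2 volume) (hT : 0 < T)
    (hfm : AEStronglyMeasurable (uncurry f) ((volume.restrict (Ioo 0 T)).prod (volume : Measure E)))
    (hf2 : eLpNorm (uncurry f) 2 ((volume.restrict (Ioo 0 T)).prod (volume : Measure E)) < ⊤)
    {Gu : ℝ → E → E →L[ℝ] E}
    (hGum : StronglyMeasurable (uncurry Gu))
    (hGu : ∀ᵐ t ∂(volume.restrict (Ioo 0 T)), HasWeakGradient (u t) (Gu t))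
    (hGu₂ : ∫⁻ t in Ioo 0 T, ∫⁻ x, ENNReal.ofReal (frobeniusNormSq (Gu t x)) < ⊤)
    {Ψ : E → E} {GΨ : E → E →L[ℝ] E} (hΨ2 : MemLp Ψ 2 volume) (hΨdiv : IsWeaklyDivFree Ψ)
    (hΨG : HasWeakGradient Ψ GΨ) (hGΨ2 : ∫⁻ x, ENNReal.ofReal (frobeniusNormSq (GΨ x)) < ⊤)
    {t : ℝ} (ht : t ∈ Ioc 0 T) :
    ∫ x, ⟪u t x, Ψ x⟫ = (∫ x, ⟪u₀ x, Ψ x⟫) +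
      ∫ s in Ioc 0 t, (((∫ x, ⟪GΨ x (u s x), u s x⟫) -
        ν * ∑ i, ∫ x, ⟪Gu s x (stdOrthonormalBasis ℝ E i), GΨ x (stdOrthonormalBasis ℝ E i)⟫) +
        ∫ x, ⟪f s x, Ψ x⟫) := by
  set b := stdOrthonormalBasis ℝ E with hb
  haveI : ENNReal.HolderTriple 4 4 2 := holderTriple_four_four_two
  have hb1 : ∀ i, ‖b i‖ = 1 := fun i => b.orthonormal.1 i
  have hGΨm : AEStronglyMeasurable GΨ volume := hΨG.aestronglyMeasurable_deriv
  -- ### the approximating test fields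
  set δ : ℕ → ℝ≥0∞ := fun n => ((n + 1 : ℕ) : ℝ≥0∞)⁻¹ with hδdef
  have hδpos : ∀ n, 0 < δ n := fun n => ENNReal.inv_pos.2 (ENNReal.natCast_ne_top _)
  have hδtop : ∀ n, δ n ≠ ⊤ := fun n =>
    ENNReal.inv_ne_top.2 (Nat.cast_ne_zero.2 (Nat.succ_ne_zero n))
  have hδlim : Tendsto δ atTop (𝓝 0) :=
    ENNReal.tendsto_inv_nat_nhds_zero.comp (tendsto_add_atTop_nat 1)
  have hδlim' : Tendsto (fun n => δ n ^ (1 / 2 : ℝ)) atTop (𝓝 0) := by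
    have := ((ENNReal.continuous_rpow_const (y := 1 / 2)).tendsto (0 : ℝ≥0∞)).comp hδlim
    rwa [ENNReal.zero_rpow_of_pos (by norm_num)] at this
  choose Φ hΦtest hΦdiv hΦL2 hΦH1 using fun n : ℕ =>
    exists_isDivFree_test_approx hE3 hΨ2 hΨdiv hΨG hGΨ2 (hδpos n)
  have hΦD : ∀ n, AEStronglyMeasurable (fderiv ℝ (Φ n)) volume := fun n =>
    ((hΦtest n).contDiff.continuous_fderiv (by simp)).aestronglyMeasurable
  have hΦDfin : ∀ n, ∫⁻ x, ENNReal.ofReal (frobeniusNormSq (fderiv ℝ (Φ n) x)) < ⊤ := by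
    intro n
    have hc : Continuous (frobeniusNormSq ∘ fderiv ℝ (Φ n)) :=
      NSWeakStrongUniqueness.continuous_frobeniusNormSq.comp
        ((hΦtest n).contDiff.continuous_fderiv (by simp))
    have hK : HasCompactSupport (frobeniusNormSq ∘ fderiv ℝ (Φ n)) :=
      ((hΦtest n).hasCompactSupport.fderiv ℝ).comp_left frobeniusNormSq_zero
    have hi : Integrable (frobeniusNormSq ∘ fderiv ℝ (Φ n)) volume :=
      hc.integrable_of_hasCompactSupport hK
    have h2 : ∫⁻ x, ‖(frobeniusNormSq ∘ fderiv ℝ (Φ n)) x‖ₑ < ⊤ := hi.2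
    refine lt_of_le_of_lt (lintegral_mono fun x => ?_) h2
    exact Real.ofReal_le_enorm _
  -- ### notation: fluxes, force pairings and the weight
  set FΦ : ℕ → ℝ → ℝ := fun n s =>
    ∫ x, (⟪u s x, convect (u s) (Φ n) x⟫ + ν * ⟪u s x, (Δ (Φ n)) x⟫) with hFΦ
  set F : ℝ → ℝ := fun s => (∫ x, ⟪GΨ x (u s x), u s x⟫) -
    ν * ∑ i, ∫ x, ⟪Gu s x (b i), GΨ x (b i)⟫ with hF
  set PΦ : ℕ → ℝ → ℝ := fun n s => ∫ x, ⟪f s x, Φ n x⟫ with hPΦ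
  set P : ℝ → ℝ := fun s => ∫ x, ⟪f s x, Ψ x⟫ with hP
  set W : ℝ → ℝ≥0∞ := fun s => eLpNorm (u s) 4 volume ^ (2 : ℝ) + ENNReal.ofReal |ν| *
    ∑ i, eLpNorm (fun x => Gu s x (b i)) 2 volume with hW
  have hIW : ∫⁻ s, W s ∂(volume.restrict (Ioo 0 T)) < ⊤ :=
    hu.lintegral_weight_lt_top hE3 hGum hGu hGu₂
  have hIf : ∫⁻ s in Ioo 0 T, eLpNorm (f s) 2 volume < ⊤ :=
    lintegral_eLpNorm_two_slice_lt_top_of_eLpNorm_prod hfm hf2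
  have hfsl : ∀ᵐ s ∂(volume.restrict (Ioo 0 T)), MemLp (f s) 2 volume :=
    ae_memLp_two_slice_of_eLpNorm_prod hfm hf2
  -- the identities for the test fields
  have hI : ∀ n, ∫ x, ⟪u t x, Φ n x⟫ = (∫ x, ⟪u₀ x, Φ n x⟫) +
      ∫ s in Ioc 0 t, (FΦ n s + PΦ n s) :=
    fun n => by rw [hFΦ, hPΦ]; exact hu.inner_test_eq_forced hT hfm hf2 (hΦtest n) (hΦdiv n) ht
  -- ### the pointwise error bound for a.e. `s`
  set D : ℝ → ℝ≥0∞ := fun s => ∫⁻ x, ENNReal.ofReal (frobeniusNormSq (Gu s x)) with hD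
  have hDm : Measurable D := measurable_lintegral_frobeniusNormSq hGum
  have hDfin : ∀ᵐ s ∂(volume.restrict (Ioo 0 T)), D s < ⊤ := ae_lt_top hDm hGu₂.ne
  have h4fin : ∀ᵐ s ∂(volume.restrict (Ioo 0 T)), eLpNorm (u s) 4 volume < ⊤ := by
    have h := ae_lt_top' ((FunctionSpaces.aemeasurable_eLpNorm_slice hu.aestronglyMeasurable_uncurry
      4).pow_const (2 : ℝ)) (hu.lintegral_eLpNorm_four_sq_lt_top hE3 hGum hGu hGu₂).ne
    filter_upwards [h] with s hs
    exact (ENNReal.rpow_lt_top_iff_of_pos zero_lt_two).1 hs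
  have hgood : ∀ᵐ s ∂(volume.restrict (Ioo 0 T)), ∀ n,
      ‖FΦ n s - F s‖ₑ ≤ δ n ^ (1 / 2 : ℝ) * W s := by
    filter_upwards [hGu, ae_restrict_mem measurableSet_Ioo, hDfin, h4fin] with s hGs hsI hDs h4s
    intro n
    have hmem2 : MemLp (u s) 2 volume := hu.memLp s (Ioo_subset_Icc_self hsI)
    have hmem4 : MemLp (u s) 4 volume := ⟨hmem2.1, h4s⟩
    -- rewrite the smooth flux in gradient form
    have i1 : Integrable (fun x => ⟪u s x, convect (u s) (Φ n) x⟫) volume :=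
      integrable_inner_fderiv_apply_of_memLp_two hmem2 hmem2 (hΦtest n)
    have i2 : Integrable (fun x => ⟪u s x, (Δ (Φ n)) x⟫) volume :=
      integrable_inner_of_memLp_two hmem2 ((hΦtest n).memLp_laplacian 2)
    have hflux : FΦ n s = (∫ x, ⟪fderiv ℝ (Φ n) x (u s x), u s x⟫) -
        ν * ∑ i, ∫ x, ⟪Gu s x (b i), fderiv ℝ (Φ n) x (b i)⟫ := by
      simp only [hFΦ]
      rw [integral_add i1 (i2.const_mul ν), MeasureTheory.integral_const_mul,
        hGs.integral_inner_laplacian_test (hΦtest n)]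
      have : ∫ x, ⟪u s x, convect (u s) (Φ n) x⟫ = ∫ x, ⟪fderiv ℝ (Φ n) x (u s x), u s x⟫ :=
        integral_congr_ae (ae_of_all _ fun x => by dsimp only; rw [convect_apply, real_inner_comm])
      rw [this]; ring
    rw [hflux]
    have hGi : ∀ i, MemLp (fun x => Gu s x (b i)) 2 volume := fun i => hGs.memLp_apply hDs i
    refine (enorm_weakFlux_sub_le hmem4 hGs.aestronglyMeasurable_deriv hGi (hΦD n) hGΨm
      (hΦDfin n) hGΨ2 ν).trans ?_
    exact mul_le_mul' (ENNReal.rpow_le_rpow (hΦH1 n) (by norm_num)) le_rfl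
  -- the force pairings: `|∫⟪f(s), Φₙ⟫ - ∫⟪f(s), Ψ⟫| ≤ ‖f(s)‖₂ δₙ` for a.e. `s`
  have hgoodP : ∀ᵐ s ∂(volume.restrict (Ioo 0 T)), ∀ n,
      ‖PΦ n s - P s‖ₑ ≤ eLpNorm (f s) 2 volume * δ n := by
    filter_upwards [hfsl] with s hfs
    intro n
    simp only [hPΦ, hP]
    rw [← integral_sub (integrable_inner_of_memLp_two hfs ((hΦtest n).memLp_volume 2))
      (integrable_inner_of_memLp_two hfs hΨ2)]
    have : (fun x => ⟪f s x, Φ n x⟫ - ⟪f s x, Ψ x⟫) = fun x => ⟪f s x, (Φ n - Ψ) x⟫ := by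
      ext x; rw [Pi.sub_apply, inner_sub_right]
    rw [this]
    exact (FunctionSpaces.enorm_integral_inner_le_eLpNorm_mul hfs.1
      (((hΦtest n).memLp_volume 2).sub hΨ2).1).trans (mul_le_mul' le_rfl (hΦL2 n))
  -- ### integrability of the fluxes and force pairings on `(0, T)`
  have hWm : AEMeasurable W (volume.restrict (Ioo 0 T)) := by
    refine ((FunctionSpaces.aemeasurable_eLpNorm_slice hu.aestronglyMeasurable_uncurry 4).pow_const
      _).add (AEMeasurable.const_mul (Finset.aemeasurable_fun_sum _ fun i _ => ?_) _)
    exact (FunctionSpaces.measurable_eLpNorm_slice (g := fun s x => Gu s x (b i))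
      ((ContinuousLinearMap.apply ℝ E (b i)).continuous.comp_stronglyMeasurable hGum)
        2).aemeasurable
  have hFΦint : ∀ n, IntegrableOn (FΦ n) (Ioo 0 T) := fun n => by
    rw [hFΦ]; exact hu.integrableOn_flux (hΦtest n)
  have hFint : IntegrableOn F (Ioo 0 T) :=
    hu.integrableOn_weakFlux hE3 hGum hGu hGu₂ hGΨm hGΨ2
  have hPΦint : ∀ n, IntegrableOn (PΦ n) (Ioo 0 T) := fun n => by
    rw [hPΦ]; exact integrableOn_forcePairing_of_eLpNorm_prod hfm hf2 ((hΦtest n).memLp_volume 2)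
  have hPint : IntegrableOn P (Ioo 0 T) := by
    rw [hP]; exact integrableOn_forcePairing_of_eLpNorm_prod hfm hf2 hΨ2
  -- ### integrability on `(0, t]`
  have hsub : Ioo 0 t ⊆ Ioo 0 T := Ioo_subset_Ioo le_rfl ht.2
  have hFΦt : ∀ n, IntegrableOn (FΦ n) (Ioc 0 t) := fun n =>
    (integrableOn_Ioc_iff_integrableOn_Ioo (hb := enorm_ne_top)).2 ((hFΦint n).mono_set hsub)
  have hFt : IntegrableOn F (Ioc 0 t) :=
    (integrableOn_Ioc_iff_integrableOn_Ioo (hb := enorm_ne_top)).2 (hFint.mono_set hsub)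
  have hPΦt : ∀ n, IntegrableOn (PΦ n) (Ioc 0 t) := fun n =>
    (integrableOn_Ioc_iff_integrableOn_Ioo (hb := enorm_ne_top)).2 ((hPΦint n).mono_set hsub)
  have hPt : IntegrableOn P (Ioc 0 t) :=
    (integrableOn_Ioc_iff_integrableOn_Ioo (hb := enorm_ne_top)).2 (hPint.mono_set hsub)
  -- ### limit of the flux integrals
  have hflux_lim : Tendsto (fun n => ∫ s in Ioc 0 t, FΦ n s) atTop (𝓝 (∫ s in Ioc 0 t, F s)) := by
    refine tendsto_of_enorm_sub_le
      (e := fun n => δ n ^ (1 / 2 : ℝ) * ∫⁻ s, W s ∂(volume.restrict (Ioo 0 T))) (fun n => ?_) ?_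
    · rw [← integral_sub (hFΦt n) hFt]
      calc ‖∫ s in Ioc 0 t, (FΦ n s - F s)‖ₑ ≤ ∫⁻ s in Ioc 0 t, ‖FΦ n s - F s‖ₑ :=
            enorm_integral_le_lintegral_enorm _
        _ = ∫⁻ s in Ioo 0 t, ‖FΦ n s - F s‖ₑ := setLIntegral_congr Ioo_ae_eq_Ioc.symm
        _ ≤ ∫⁻ s in Ioo 0 T, ‖FΦ n s - F s‖ₑ := lintegral_mono_set hsub
        _ ≤ ∫⁻ s in Ioo 0 T, δ n ^ (1 / 2 : ℝ) * W s :=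
            lintegral_mono_ae (hgood.mono fun s hs => hs n)
        _ = δ n ^ (1 / 2 : ℝ) * ∫⁻ s, W s ∂(volume.restrict (Ioo 0 T)) :=
            lintegral_const_mul'' _ hWm
    · have h := ENNReal.Tendsto.mul_const hδlim' (Or.inr hIW.ne)
      rwa [zero_mul] at h
  -- ### limit of the force pairings
  have hforce_lim : Tendsto (fun n => ∫ s in Ioc 0 t, PΦ n s) atTop (𝓝 (∫ s in Ioc 0 t, P s)) := by
    refine tendsto_of_enorm_sub_le
      (e := fun n => (∫⁻ s in Ioo 0 T, eLpNorm (f s) 2 volume) * δ n) (fun n => ?_) ?_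
    · rw [← integral_sub (hPΦt n) hPt]
      calc ‖∫ s in Ioc 0 t, (PΦ n s - P s)‖ₑ ≤ ∫⁻ s in Ioc 0 t, ‖PΦ n s - P s‖ₑ :=
            enorm_integral_le_lintegral_enorm _
        _ = ∫⁻ s in Ioo 0 t, ‖PΦ n s - P s‖ₑ := setLIntegral_congr Ioo_ae_eq_Ioc.symm
        _ ≤ ∫⁻ s in Ioo 0 T, ‖PΦ n s - P s‖ₑ := lintegral_mono_set hsub
        _ ≤ ∫⁻ s in Ioo 0 T, eLpNorm (f s) 2 volume * δ n :=
            lintegral_mono_ae (hgoodP.mono fun s hs => hs n)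
        _ = (∫⁻ s in Ioo 0 T, eLpNorm (f s) 2 volume) * δ n :=
            lintegral_mul_const' _ _ (hδtop n)
    · have h := ENNReal.Tendsto.const_mul hδlim (Or.inr hIf.ne)
      rwa [mul_zero] at h
  -- ### limits of the pairings
  have hpair : ∀ {v : E → E}, MemLp v 2 volume →
      Tendsto (fun n => ∫ x, ⟪v x, Φ n x⟫) atTop (𝓝 (∫ x, ⟪v x, Ψ x⟫)) := by
    intro v hv
    refine tendsto_of_enorm_sub_le (e := fun n => eLpNorm v 2 volume * δ n) (fun n => ?_) ?_
    · rw [← integral_sub (integrable_inner_of_memLp_two hv ((hΦtest n).memLp_volume 2))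
        (integrable_inner_of_memLp_two hv hΨ2)]
      have : (fun x => ⟪v x, Φ n x⟫ - ⟪v x, Ψ x⟫) = fun x => ⟪v x, (Φ n - Ψ) x⟫ := by
        ext x; rw [Pi.sub_apply, inner_sub_right]
      rw [this]
      exact (FunctionSpaces.enorm_integral_inner_le_eLpNorm_mul hv.1
        (((hΦtest n).memLp_volume 2).sub hΨ2).1).trans (mul_le_mul' le_rfl (hΦL2 n))
    · have h := ENNReal.Tendsto.const_mul hδlim (Or.inr hv.eLpNorm_ne_top)
      rwa [mul_zero] at h
  have hL := hpair (hu.memLp t ⟨ht.1.le, ht.2⟩)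
  have hR := (hpair hu₀).add (hflux_lim.add hforce_lim)
  have hLR : (fun n => ∫ x, ⟪u t x, Φ n x⟫) =
      fun n => (∫ x, ⟪u₀ x, Φ n x⟫) + ((∫ s in Ioc 0 t, FΦ n s) + ∫ s in Ioc 0 t, PΦ n s) := by
    funext n
    rw [hI n, integral_add (hFΦt n) (hPΦt n)]
  rw [hLR] at hL
  have hsum : (∫ s in Ioc 0 t, F s) + ∫ s in Ioc 0 t, P s = ∫ s in Ioc 0 t, (F s + P s) :=
    (integral_add hFt hPt).symm
  rw [hsum] at hR
  exact tendsto_nhds_unique hL hR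

end H1TestForced

end Literature.Analysis.FluidPDE
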